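import Mathlib
import Literature.Probability.LatticeModels.GKSInequalities
import HarnessLib

/-!
# Crux `PrecisionLaplacian.InverseMFerromagnet` (stmt-CriticalPhenomena-4798), line `Sketch` —
# stub `stub_level_two` (level two of the partial-covariance ladder, "FourPointInverseM")

THEOREM-ONLY file (no definitions).  For the zero-field pair ferromagnet `gksExpect univ K C`
(`K ≥ 0`, `|C i| = 2`) with second-moment matrix `G p q = ⟨σ_pσ_q⟩`, level two of the line says:
for `S = {u,v} ∌ x, y`, the partial covariance
`PCov(x,y|S) = G x y − Σ_{p,q∈S} G x p ((G_SS)⁻¹)_{pq} G q y` is nonnegative, GIVEN the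
conditional-covariance inequality `Σ_s E[σ_x 1_s] E[σ_y 1_s] / P(s) ≤ ⟨σ_xσ_y⟩`
(`1_s = ∏_{p∈S}(1+s_pσ_p)/2`, the statement of the neighbour stub `stub_condCov_nonneg`, taken here
as a hypothesis).  The point: `s ↦ E[σ_x | σ_S = s]` is odd under the global spin flip (zero
field, even interactions), and an odd function of two `±1` spins is linear, so the linear
regression of `σ_x` on `(σ_u, σ_v)` is the conditional expectation and
`Σ_{p,q} G x p ((G_SS)⁻¹)_{pq} G q y = Σ_s E[σ_x 1_s] E[σ_y 1_s] / P(s)`.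
-/

namespace Summit.CriticalPhenomena.Ising3DConformalLimit.Cruxes.InverseMFerromagnet.PartialCovarianceLadder

open Literature.Probability.LatticeModels Finset Matrix

/-! ## General facts about the zero-field pair system `gksExpect univ K C` -/

/-- Linearity of `gksExpect` over finite linear combinations. [folklore] -/
theorem l2_gksExpect_sum_mul {n m : ℕ} {ι : Type*} (t : Finset ι) (K : Fin m → ℝ)
    (C : Fin m → Finset (Fin n)) (c : ι → ℝ) (f : ι → SpinConfig (Fin n) → ℝ) :
    gksExpect Finset.univ K C (fun ω => ∑ i ∈ t, c i * f i ω)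
      = ∑ i ∈ t, c i * gksExpect Finset.univ K C (f i) := by
  have h : ∑ ω, (∑ i ∈ t, c i * f i ω) * gksWeight Finset.univ K C ω
      = ∑ i ∈ t, c i * ∑ ω, f i ω * gksWeight Finset.univ K C ω := by
    simp_rw [Finset.sum_mul, Finset.mul_sum, mul_assoc]
    exact Finset.sum_comm
  simp only [gksExpect, gksSum, h, Finset.sum_div, mul_div_assoc]

/-- `E[-f] = -E[f]`. [folklore] -/
theorem l2_gksExpect_neg {n m : ℕ} (K : Fin m → ℝ) (C : Fin m → Finset (Fin n))
    (f : SpinConfig (Fin n) → ℝ) :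
    gksExpect Finset.univ K C (fun ω => -f ω) = -gksExpect Finset.univ K C f := by
  simp only [gksExpect, gksSum, neg_mul, Finset.sum_neg_distrib, neg_div]

/-- `σ_z(-ω) = -σ_z(ω)`. [folklore] -/
theorem l2_spinAt_neg {n : ℕ} (z : Fin n) (ω : SpinConfig (Fin n)) :
    spinAt z (-ω) = -spinAt z ω := by
  simp [spinAt, Units.val_neg]

/-- The Boltzmann weight of a pair system (`|C i| = 2`) is invariant under the global flip. [folklore] -/
theorem l2_gksWeight_neg {n m : ℕ} (K : Fin m → ℝ) (C : Fin m → Finset (Fin n))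
    (hC : ∀ i, (C i).card = 2) (ω : SpinConfig (Fin n)) :
    gksWeight Finset.univ K C (-ω) = gksWeight Finset.univ K C ω := by
  simp only [gksWeight, gksHamiltonian]
  congr 1
  refine Finset.sum_congr rfl fun i _ => ?_
  congr 1
  simp only [spinProduct]
  rw [show (∏ z ∈ C i, spinAt z (-ω)) = ∏ z ∈ C i, -spinAt z ω from
      Finset.prod_congr rfl fun z _ => l2_spinAt_neg z ω, Finset.prod_neg, hC i]
  norm_num

/-- `E[f ∘ flip] = E[f]` for a pair system. [folklore] -/
theorem l2_gksExpect_comp_neg {n m : ℕ} (K : Fin m → ℝ) (C : Fin m → Finset (Fin n))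
    (hC : ∀ i, (C i).card = 2) (f : SpinConfig (Fin n) → ℝ) :
    gksExpect Finset.univ K C (fun ω => f (-ω)) = gksExpect Finset.univ K C f := by
  simp only [gksExpect, gksSum]
  congr 1
  calc ∑ ω, f (-ω) * gksWeight Finset.univ K C ω
      = ∑ ω, f (-ω) * gksWeight Finset.univ K C (-ω) := by simp_rw [l2_gksWeight_neg K C hC]
    _ = ∑ ω, f ω * gksWeight Finset.univ K C ω :=
        Equiv.sum_comp (Equiv.neg _) (fun ω => f ω * gksWeight Finset.univ K C ω)

/-! ## The cylinder indicators `1_s = ∏_{p∈S}(1 + s_p σ_p)/2` -/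

/-- `1_s(ω) = 1` if `ω` agrees with `s` on `S`, else `0`. [folklore] -/
theorem l2_ind_eq_ite {n : ℕ} (S : Finset (Fin n)) (s : ↥S → ℤˣ) (ω : SpinConfig (Fin n)) :
    (∏ p : ↥S, (1 + (((s p : ℤˣ) : ℤ) : ℝ) * spinAt p.1 ω) / 2)
      = if s = (fun p : ↥S => ω p.1) then 1 else 0 := by
  have h1 : (1 : ℤˣ) ≠ -1 := by decide
  have h2 : (-1 : ℤˣ) ≠ 1 := by decide
  have hfac : ∀ p : ↥S, (1 + (((s p : ℤˣ) : ℤ) : ℝ) * spinAt p.1 ω) / 2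
      = if s p = ω p.1 then 1 else 0 := by
    intro p
    unfold spinAt
    rcases Int.units_eq_one_or (s p) with h | h <;>
      rcases Int.units_eq_one_or (ω p.1) with h' | h' <;> simp [h, h', h1, h2]
  simp_rw [hfac]
  rw [Fintype.prod_boole]
  exact if_congr (by simp [funext_iff]) rfl rfl

/-- `Σ_s 1_s(ω) g(s) = g(ω|_S)`. [folklore] -/
theorem l2_sum_ind_mul {n : ℕ} (S : Finset (Fin n)) (ω : SpinConfig (Fin n)) (g : (↥S → ℤˣ) → ℝ) :
    ∑ s : ↥S → ℤˣ, (∏ p : ↥S, (1 + (((s p : ℤˣ) : ℤ) : ℝ) * spinAt p.1 ω) / 2) * g s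
      = g (fun p : ↥S => ω p.1) := by
  simp_rw [l2_ind_eq_ite, ite_mul, one_mul, zero_mul]
  simp

/-- `1_{-s}(ω) = 1_s(-ω)`. [folklore] -/
theorem l2_ind_neg {n : ℕ} (S : Finset (Fin n)) (s : ↥S → ℤˣ) (ω : SpinConfig (Fin n)) :
    (∏ p : ↥S, (1 + ((((-s) p : ℤˣ) : ℤ) : ℝ) * spinAt p.1 ω) / 2)
      = ∏ p : ↥S, (1 + (((s p : ℤˣ) : ℤ) : ℝ) * spinAt p.1 (-ω)) / 2 := by
  refine Finset.prod_congr rfl fun p _ => ?_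
  rw [l2_spinAt_neg]
  simp [Units.val_neg]

/-- `P(s) = E[1_s] > 0`: every configuration has positive weight. [folklore] -/
theorem l2_P_pos {n m : ℕ} (K : Fin m → ℝ) (C : Fin m → Finset (Fin n)) (S : Finset (Fin n))
    (s : ↥S → ℤˣ) :
    0 < gksExpect Finset.univ K C
      (fun ω => ∏ p : ↥S, (1 + (((s p : ℤˣ) : ℤ) : ℝ) * spinAt p.1 ω) / 2) := by
  simp only [gksExpect]
  refine div_pos ?_ (gksSum_one_pos _ _ _)
  simp only [gksSum]
  simp_rw [l2_ind_eq_ite]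
  set ω₀ : SpinConfig (Fin n) := fun z => if h : z ∈ S then s ⟨z, h⟩ else 1 with hω₀
  have h0 : (s = fun p : ↥S => ω₀ p.1) := by
    funext p
    simp [hω₀, p.2]
  calc (0 : ℝ) < 1 * gksWeight Finset.univ K C ω₀ := by
        rw [one_mul]; exact gksWeight_pos _ _ _ _
    _ = (if s = fun p : ↥S => ω₀ p.1 then 1 else 0) * gksWeight Finset.univ K C ω₀ := by
        rw [if_pos h0]
    _ ≤ ∑ ω, (if s = fun p : ↥S => ω p.1 then 1 else 0) * gksWeight Finset.univ K C ω :=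
        Finset.single_le_sum
          (f := fun ω => (if s = fun p : ↥S => ω p.1 then 1 else 0) * gksWeight Finset.univ K C ω)
          (fun ω _ => mul_nonneg (by split_ifs <;> norm_num) (gksWeight_pos _ _ _ _).le)
          (Finset.mem_univ ω₀)

/-! ## An odd function of two `±1` spins is linear -/

/-- On `ι → ℤˣ` with `|ι| = 2`, every function odd under `s ↦ -s` is of the form
`s ↦ Σ_p λ_p s_p`. [folklore] -/
theorem l2_odd_linear {ι : Type*} [Fintype ι] [DecidableEq ι] (hι : Fintype.card ι = 2)
    (f : (ι → ℤˣ) → ℝ) (hf : ∀ s, f (-s) = -f s) :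
    ∃ lam : ι → ℝ, ∀ s, f s = ∑ p, lam p * (((s p : ℤˣ) : ℤ) : ℝ) := by
  obtain ⟨a, b, hab, huniv⟩ := Finset.card_eq_two.1 ((Finset.card_univ (α := ι)).trans hι)
  have hmem : ∀ p : ι, p = a ∨ p = b := fun p => by
    simpa [huniv] using Finset.mem_univ p
  have hba : b ≠ a := fun h => hab h.symm
  set s₁ : ι → ℤˣ := fun _ => 1 with hs₁
  set s₂ : ι → ℤˣ := fun p => if p = a then 1 else -1 with hs₂
  refine ⟨fun p => if p = a then (f s₁ + f s₂) / 2 else (f s₁ - f s₂) / 2, fun s => ?_⟩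
  have hsum : ∀ g : ι → ℝ, ∑ p, g p = g a + g b := fun g => by
    rw [show (Finset.univ : Finset ι) = {a, b} from huniv, Finset.sum_pair hab]
  rw [hsum]
  simp only [if_neg hba]
  have key : s = s₁ ∨ s = s₂ ∨ s = -s₂ ∨ s = -s₁ := by
    rcases Int.units_eq_one_or (s a) with ha | ha <;>
      rcases Int.units_eq_one_or (s b) with hb | hb
    · refine Or.inl (funext fun p => ?_)
      rcases hmem p with rfl | rfl <;> simp [hs₁, ha, hb]
    · refine Or.inr (Or.inl (funext fun p => ?_))
      rcases hmem p with rfl | rfl <;> simp [hs₂, ha, hb, hba]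
    · refine Or.inr (Or.inr (Or.inl (funext fun p => ?_)))
      rcases hmem p with rfl | rfl <;> simp [hs₂, ha, hb, hba]
    · refine Or.inr (Or.inr (Or.inr (funext fun p => ?_)))
      rcases hmem p with rfl | rfl <;> simp [hs₁, ha, hb]
  rcases key with rfl | rfl | rfl | rfl
  · simp only [hs₁, ↓reduceIte, Units.val_one, Int.cast_one, mul_one]
    ring
  · simp only [hs₂, ↓reduceIte, Units.val_one, Int.cast_one, mul_one, hba, Units.val_neg,
      Int.reduceNeg, Int.cast_neg, mul_neg]
    ring
  · rw [hf]
    simp only [hs₂, ↓reduceIte, Pi.neg_apply, Units.val_neg, Units.val_one, Int.reduceNeg,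
      Int.cast_neg, Int.cast_one, mul_neg, mul_one, hba, neg_neg]
    ring
  · rw [hf]
    simp only [hs₁, ↓reduceIte, Pi.neg_apply, Units.val_neg, Units.val_one, Int.reduceNeg,
      Int.cast_neg, Int.cast_one, mul_neg, mul_one]
    ring

/-! ## Level two -/

/-- Registered stub `stub_level_two` (level two of the partial-covariance ladder,
"FourPointInverseM"): given the conditional-covariance inequality (the statement of
`stub_condCov_nonneg`), `PCov(x,y | {u,v}) ≥ 0`, because the conditional expectation of a spin
given two spins is odd, hence linear, hence equal to the linear regression. [folklore] -/
theorem stub_level_two : (∀ (n m : ℕ) (K : Fin m → ℝ) (C : Fin m → Finset (Fin n)), (∀ i, 0 ≤ K i) → (∀ i, (C i).card = 2) → ∀ (x y : Fin n) (S : Finset (Fin n)), x ∉ S → y ∉ S → ∑ s : (↥S → ℤˣ), gksExpect Finset.univ K C (fun ω => spinAt x ω * ∏ p : ↥S, (1 + (((s p : ℤˣ) : ℤ) : ℝ) * spinAt p.1 ω) / 2) * gksExpect Finset.univ K C (fun ω => spinAt y ω * ∏ p : ↥S, (1 + (((s p : ℤˣ) : ℤ) : ℝ) * spinAt p.1 ω)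 / 2) / gksExpect Finset.univ K C (fun ω => ∏ p : ↥S, (1 + (((s p : ℤˣ) : ℤ) : ℝ) * spinAt p.1 ω) / 2) ≤ gksExpect Finset.univ K C (fun ω => spinAt x ω * spinAt y ω)) → ∀ (n m : ℕ) (K : Fin m → ℝ) (C : Fin m → Finset (Fin n)), (∀ i, 0 ≤ K i) → (∀ i, (C i).card = 2) → ∀ G : Matrix (Fin n) (Fin n) ℝ, G = Matrix.of (fun p q : Fin n => gksExpect Finset.univ K C (fun ω => spinAt p ω * spinAt q ω)) → ∀ (x y : Fin n) (S : Finset (Fin n)), x ≠ y → x ∉ S → y ∉ S → S.card = 2 → 0 ≤ G x y - ∑ p : ↥S, ∑ q : ↥S, G x p.1 * (G.submatrix (Subtype.val : ↥S → Fin n) (Subtype.val : ↥S → Fin n))⁻¹ p q * G q.1 y := by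
  intro H0 n m K C hK hC G hG x y S hxy hx hy hS2
  subst hG
  set A : Matrix (Fin n) (Fin n) ℝ :=
    Matrix.of (fun p q : Fin n => gksExpect Finset.univ K C (fun ω => spinAt p ω * spinAt q ω)) with hA
  set M : Matrix ↥S ↥S ℝ :=
    A.submatrix (Subtype.val : ↥S → Fin n) (Subtype.val : ↥S → Fin n) with hM
  have hsymm : ∀ p q, A p q = A q p := fun p q => by
    simp only [hA, Matrix.of_apply, mul_comm]
  have hAxy : 0 ≤ A x y := by
    have h : A x y = gksExpect Finset.univ K C (spinProduct {x, y}) := by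
      simp only [hA, Matrix.of_apply]
      congr 1
      funext ω
      simp [spinProduct, Finset.prod_pair hxy]
    rw [h]
    exact gksExpect_spinProduct_nonneg _ _ _ (fun i _ => hK i) _
  by_cases hunit : IsUnit M.det
  swap
  · rw [Matrix.nonsing_inv_apply_not_isUnit _ hunit]
    simpa using hAxy
  -- cylinder indicators, folded into an opaque function `ind`
  obtain ⟨ind, hind⟩ : ∃ ind : (↥S → ℤˣ) → SpinConfig (Fin n) → ℝ,
      ∀ s ω, ind s ω = ∏ p : ↥S, (1 + (((s p : ℤˣ) : ℤ) : ℝ) * spinAt p.1 ω) / 2 :=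
    ⟨_, fun _ _ => rfl⟩
  have hindneg : ∀ s ω, ind (-s) ω = ind s (-ω) := fun s ω => by
    rw [hind, hind]
    exact l2_ind_neg S s ω
  -- `P s = E[1_s]`, `a z s = E[σ_z 1_s]`, `mz z s = E[σ_z | σ_S = s]`, as opaque functions
  obtain ⟨P, hPdef⟩ : ∃ P : (↥S → ℤˣ) → ℝ,
      ∀ s, P s = gksExpect Finset.univ K C (fun ω => ind s ω) := ⟨_, fun _ => rfl⟩
  obtain ⟨a, hadef⟩ : ∃ a : Fin n → (↥S → ℤˣ) → ℝ,
      ∀ z s, a z s = gksExpect Finset.univ K C (fun ω => spinAt z ω * ind s ω) :=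
    ⟨_, fun _ _ => rfl⟩
  obtain ⟨mz, hmdef⟩ : ∃ mz : Fin n → (↥S → ℤˣ) → ℝ, ∀ z s, mz z s = a z s / P s :=
    ⟨_, fun _ _ => rfl⟩
  -- the hypothesis, in this notation
  have H := H0 n m K C hK hC x y S hx hy
  clear H0
  simp only [← hind, ← hPdef, ← hadef] at H
  -- positivity and flip symmetry
  have hPpos : ∀ s, 0 < P s := fun s => by
    rw [hPdef]
    simp only [hind]
    exact l2_P_pos K C S s
  have hPneg : ∀ s, P (-s) = P s := fun s => by
    rw [hPdef, hPdef]
    simp_rw [hindneg]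
    exact l2_gksExpect_comp_neg K C hC _
  have haneg : ∀ z s, a z (-s) = -a z s := fun z s => by
    rw [hadef, hadef]
    simp_rw [hindneg]
    have h1 : (fun ω => spinAt z ω * ind s (-ω))
        = fun ω => (fun ω' => -(spinAt z ω' * ind s ω')) (-ω) := by
      funext ω
      simp [l2_spinAt_neg]
    rw [h1, l2_gksExpect_comp_neg K C hC (fun ω' => -(spinAt z ω' * ind s ω')), l2_gksExpect_neg]
  have hodd : ∀ z s, mz z (-s) = -mz z s := fun z s => by
    rw [hmdef, hmdef, haneg, hPneg, neg_div]
  have ha_eq : ∀ z s, a z s = P s * mz z s := fun z s => by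
    rw [hmdef]
    field_simp [(hPpos s).ne']
  -- second moments against the cylinder functions
  have hcol : ∀ (z : Fin n) (p : ↥S), A z p.1 = ∑ s, a z s * (((s p : ℤˣ) : ℤ) : ℝ) := by
    intro z p
    calc A z p.1 = gksExpect Finset.univ K C (fun ω => spinAt z ω * spinAt p.1 ω) := by
          simp [hA]
      _ = gksExpect Finset.univ K C
            (fun ω => ∑ s : ↥S → ℤˣ, (((s p : ℤˣ) : ℤ) : ℝ) * (spinAt z ω * ind s ω)) := by
          congr 1
          funext ω
          have h := l2_sum_ind_mul S ω (fun s => (((s p : ℤˣ) : ℤ) : ℝ))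
          simp only [← hind] at h
          rw [show (∑ s : ↥S → ℤˣ, (((s p : ℤˣ) : ℤ) : ℝ) * (spinAt z ω * ind s ω))
              = spinAt z ω * ∑ s : ↥S → ℤˣ, ind s ω * (((s p : ℤˣ) : ℤ) : ℝ) by
            rw [Finset.mul_sum]
            exact Finset.sum_congr rfl fun s _ => by ring, h]
          rfl
      _ = ∑ s, (((s p : ℤˣ) : ℤ) : ℝ) * a z s := by
          rw [l2_gksExpect_sum_mul]
          simp only [hadef]
      _ = ∑ s, a z s * (((s p : ℤˣ) : ℤ) : ℝ) := Finset.sum_congr rfl fun s _ => mul_comm _ _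
  have hgram : ∀ p q : ↥S, A p.1 q.1
      = ∑ s, P s * (((s p : ℤˣ) : ℤ) : ℝ) * (((s q : ℤˣ) : ℤ) : ℝ) := by
    intro p q
    calc A p.1 q.1 = gksExpect Finset.univ K C (fun ω => spinAt p.1 ω * spinAt q.1 ω) := by
          simp [hA]
      _ = gksExpect Finset.univ K C
            (fun ω => ∑ s : ↥S → ℤˣ,
              ((((s p : ℤˣ) : ℤ) : ℝ) * (((s q : ℤˣ) : ℤ) : ℝ)) * ind s ω) := by
          congr 1
          funext ω
          have h := l2_sum_ind_mul S ω (fun s => (((s p : ℤˣ) : ℤ) : ℝ) * (((s q : ℤˣ) : ℤ) : ℝ))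
          simp only [← hind] at h
          rw [show (∑ s : ↥S → ℤˣ, ((((s p : ℤˣ) : ℤ) : ℝ) * (((s q : ℤˣ) : ℤ) : ℝ)) * ind s ω)
              = ∑ s : ↥S → ℤˣ, ind s ω * ((((s p : ℤˣ) : ℤ) : ℝ) * (((s q : ℤˣ) : ℤ) : ℝ)) from
            Finset.sum_congr rfl fun s _ => mul_comm _ _, h]
          rfl
      _ = ∑ s, ((((s p : ℤˣ) : ℤ) : ℝ) * (((s q : ℤˣ) : ℤ) : ℝ)) * P s := by
          rw [l2_gksExpect_sum_mul]
          simp only [hPdef]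
      _ = ∑ s, P s * (((s p : ℤˣ) : ℤ) : ℝ) * (((s q : ℤˣ) : ℤ) : ℝ) :=
          Finset.sum_congr rfl fun s _ => by ring
  -- odd functions of two spins are linear: the conditional expectations `mz x`, `mz y`
  have hcard : Fintype.card ↥S = 2 := by simp [hS2]
  obtain ⟨lx, hlx⟩ := l2_odd_linear hcard (mz x) (hodd x)
  obtain ⟨ly, hly⟩ := l2_odd_linear hcard (mz y) (hodd y)
  -- `(A z p)_{p ∈ S} = M λ^z`
  have hg : ∀ (z : Fin n) (lam : ↥S → ℝ),
      (∀ s, mz z s = ∑ q, lam q * (((s q : ℤˣ) : ℤ) : ℝ)) →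
        ∀ p : ↥S, A z p.1 = ∑ q, M p q * lam q := by
    intro z lam hlam p
    calc A z p.1 = ∑ s, a z s * (((s p : ℤˣ) : ℤ) : ℝ) := hcol z p
      _ = ∑ s, ∑ q, P s * (((s p : ℤˣ) : ℤ) : ℝ) * (((s q : ℤˣ) : ℤ) : ℝ) * lam q := by
          refine Finset.sum_congr rfl fun s _ => ?_
          rw [ha_eq z s, hlam s, Finset.mul_sum, Finset.sum_mul]
          exact Finset.sum_congr rfl fun q _ => by ring
      _ = ∑ q, (∑ s, P s * (((s p : ℤˣ) : ℤ) : ℝ) * (((s q : ℤˣ) : ℤ) : ℝ)) * lam q := by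
          rw [Finset.sum_comm]
          exact Finset.sum_congr rfl fun q _ => by rw [Finset.sum_mul]
      _ = ∑ q, M p q * lam q := by
          refine Finset.sum_congr rfl fun q _ => ?_
          rw [← hgram p q]
          rfl
  -- both sides of the claimed identity equal `V = Σ_p (M λ^x)_p λ^y_p`
  have hT : ∑ p : ↥S, ∑ q : ↥S, A x p.1 * M⁻¹ p q * A q.1 y = ∑ p, (∑ q, M p q * lx q) * ly p := by
    have hMv : ∀ p, (M⁻¹.mulVec (M.mulVec ly)) p = ly p := by
      intro p
      rw [Matrix.mulVec_mulVec, Matrix.nonsing_inv_mul _ hunit, Matrix.one_mulVec]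
    refine Finset.sum_congr rfl fun p _ => ?_
    calc ∑ q, A x p.1 * M⁻¹ p q * A q.1 y = A x p.1 * ∑ q, M⁻¹ p q * (M.mulVec ly) q := by
          rw [Finset.mul_sum]
          refine Finset.sum_congr rfl fun q _ => ?_
          rw [hsymm q.1 y, hg y ly hly q]
          simp only [Matrix.mulVec, dotProduct]
          ring
      _ = A x p.1 * ly p := by
          rw [← hMv p]
          simp only [Matrix.mulVec, dotProduct]
      _ = (∑ q, M p q * lx q) * ly p := by rw [hg x lx hlx p]
  have hH : ∑ s, a x s * a y s / P s = ∑ p, (∑ q, M p q * lx q) * ly p := by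
    calc ∑ s, a x s * a y s / P s = ∑ s, P s * mz x s * mz y s := by
          refine Finset.sum_congr rfl fun s _ => ?_
          rw [ha_eq x s, ha_eq y s]
          field_simp [(hPpos s).ne']
      _ = ∑ s, ∑ p, ∑ q, P s * (((s p : ℤˣ) : ℤ) : ℝ) * (((s q : ℤˣ) : ℤ) : ℝ) * lx q * ly p := by
          refine Finset.sum_congr rfl fun s _ => ?_
          rw [hlx s, hly s, mul_assoc, Finset.sum_mul_sum]
          simp_rw [Finset.mul_sum]
          rw [Finset.sum_comm]
          exact Finset.sum_congr rfl fun p _ => Finset.sum_congr rfl fun q _ => by ring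
      _ = ∑ p, ∑ q, (∑ s, P s * (((s p : ℤˣ) : ℤ) : ℝ) * (((s q : ℤˣ) : ℤ) : ℝ)) * lx q * ly p := by
          rw [Finset.sum_comm]
          refine Finset.sum_congr rfl fun p _ => ?_
          rw [Finset.sum_comm]
          refine Finset.sum_congr rfl fun q _ => ?_
          rw [Finset.sum_mul, Finset.sum_mul]
      _ = ∑ p, (∑ q, M p q * lx q) * ly p := by
          refine Finset.sum_congr rfl fun p _ => ?_
          rw [Finset.sum_mul]
          refine Finset.sum_congr rfl fun q _ => ?_
          rw [← hgram p q]
          rfl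
  have hfin : A x y = gksExpect Finset.univ K C (fun ω => spinAt x ω * spinAt y ω) := by simp [hA]
  rw [hT]
  rw [hH] at H
  linarith

end Summit.CriticalPhenomena.Ising3DConformalLimit.Cruxes.InverseMFerromagnet.PartialCovarianceLadder
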